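import Summits.QuantumAdvantage.AdviceFreeQNC0.HammingLayerSums
import HarnessLib

/-!
# Cell qa-qnc0 (rung F-Q1, route RingFrame, crux α, line `product`): symmetrised coverage of the
# cube by permuted copies of a support, and a degree-free OR-reduction

Combinatorial half of the coverage–avoidance inequality (`CoverageResidueAvoidance.lean`, same
directory), over an arbitrary field `F`.  For `g : {0,1}ⁿ → F` write `ψ_k = nzFrac g k` for the
fraction of the Hamming layer `{|u| = k}` on which `g ≠ 0` (the tree's `Hegedus.nzFrac`) and let

  `cov_m(g) := Σ_{x ∈ {0,1}ⁿ} (1 − (1 − ψ_{|x|})^m) = Σ_k C(n,k)·(1 − (1 − ψ_k)^m)`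

(kept as an explicit sum in all statements; `cov_eq_sum_layers`, `cov_one : cov_1(g) = #{g ≠ 0}`).

* `sum_card_cover_eq`, `exists_perms_cover` (SYMMETRISATION, probabilistic method as a double
  count): summed over all `m`-tuples `(π_1,…,π_m)` of coordinate permutations, the number of points
  covered by some copy `{x : g(x ∘ π_i) ≠ 0}` is `(n!)^m · cov_m(g)`; hence some tuple covers at least
  `cov_m(g)` points.  The single-copy count `#{π : g(b ∘ π) ≠ 0} = n!·ψ_{|b|}` is Srinivasan's
  "a^π is uniformly distributed over its layer" (tree: `Hegedus.card_perm_filter_eq_mul_nzFrac`,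
  `card_pi_perm_filter`).
* `exists_subset_sum_support_ge` (DEGREE-FREE OR-REDUCTION — one round of Razborov's 1987
  approximation of OR by random sub-sums): for any finite family `g_i` of cube functions some
  SUB-SUM `Σ_{i ∈ S} g_i` is non-zero on at least half of the points where some `g_i` is non-zero
  (at such a point, toggling one index `i₀` with `g_{i₀}(x) ≠ 0` in or out of `S` moves the sub-sum
  off zero: an injection from the vanishing to the non-vanishing sub-sums,
  `card_filter_sum_eq_zero_le`, `two_pow_le_two_mul_card_filter_sum_ne_zero`).  A sub-sum of
  degree-`d` functions has degree `d`: no degree is lost, unlike the `s`-round version.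
* `card_filter_comp_perm_class`: a permuted copy meets each class `|u| ≡ r (mod 3)` in exactly as
  many points as the original.

WHAT THIS IS NOT: pure counting; the avoidance consequences are in `CoverageResidueAvoidance.lean`.

## References

* S. Srinivasan, *A robust version of Hegedűs's lemma, with applications*, TheoretiCS 2 (2023),
  Lemma 3.10 (random permutations of a polynomial) [Srinivasan2023].
* A. A. Razborov, *Lower bounds on the size of bounded depth circuits over a complete basis with
  logical addition*, Math. Notes 41 (1987) — the random sub-sum approximation of OR [Razborov1987].
-/

noncomputable section

namespace Summit.QuantumAdvantage.AdviceFreeQNC0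

open Finset
open Literature.Computability.MetaComplexity Literature.Computability.MetaComplexity.Smolensky
open Literature.Computability.MetaComplexity.Hegedus

variable {n : ℕ}


variable {F : Type*} [Field F] [DecidableEq F]

/-! ### The symmetrised coverage functional -/

/-- **Symmetrised `m`-fold coverage**, point form versus layer form:
`Σ_x (1 − (1 − ψ_{|x|})^m) = Σ_{k ≤ n} C(n,k)·(1 − (1 − ψ_k)^m)` (`ψ_k = nzFrac g k` the non-vanishing
fraction of layer `k`); this quantity is the expected number of points covered by `m` independent
uniformly permuted copies of `{g ≠ 0}` (`sum_card_cover_eq`). [folklore] -/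
theorem cov_eq_sum_layers (g : CubeFn F n) (m : ℕ) :
    ∑ x : Fin n → Bool, (1 - (1 - nzFrac g (wt x)) ^ m) =
      ∑ k ∈ range (n + 1), (n.choose k : ℝ) * (1 - (1 - nzFrac g k) ^ m) := by
  rw [← sum_fiberwise_of_maps_to' (s := (univ : Finset (Fin n → Bool))) (t := range (n + 1))
    (g := fun x : Fin n → Bool => wt x) (fun x _ => mem_range.2 (Nat.lt_succ_of_le (wt_le_dim x)))
    (fun k => (1 - (1 - nzFrac g k) ^ m))]
  refine sum_congr rfl fun k _ => ?_
  rw [sum_const, nsmul_eq_mul]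
  congr 1
  rw [← card_layer n k]
  rfl

/-- Each coverage term is non-negative: `0 ≤ 1 − (1 − ψ)^m`. [folklore] -/
theorem cov_term_nonneg (g : CubeFn F n) (k m : ℕ) : 0 ≤ 1 - (1 - nzFrac g k) ^ m := by
  have h0 := nzFrac_nonneg g k
  have h1 := nzFrac_le_one g k
  have : (1 - nzFrac g k) ^ m ≤ 1 := pow_le_one₀ (by linarith) (by linarith)
  linarith

/-- One copy covers exactly the support: `Σ_k C(n,k)·(1 − (1 − ψ_k)^1) = #{g ≠ 0}`. [folklore] -/
theorem cov_one (g : CubeFn F n) :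
    ∑ k ∈ range (n + 1), (n.choose k : ℝ) * (1 - (1 - nzFrac g k) ^ 1) =
      ((univ.filter fun u : Fin n → Bool => g u ≠ 0).card : ℝ) := by
  rw [card_filter_ne_zero_eq_sum, Nat.cast_sum]
  refine sum_congr rfl fun k hk => ?_
  rw [pow_one, sub_sub_cancel, card_filter_layer_eq_nzFrac_mul g (Nat.lt_succ_iff.1 (mem_range.1 hk)),
    mul_comm]

/-! ### Step 1: symmetrisation — `m` permuted copies cover `cov_m(g)` points on average -/

/-- The complementary indicator `u ↦ [g u = 0]` (to reuse the tree's permutation counts, which are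
stated for non-vanishing): it is non-zero exactly where `g` vanishes. [folklore] -/
private theorem zeroInd_ne_zero_iff (g : CubeFn F n) (u : Fin n → Bool) :
    (fun u : Fin n → Bool => if g u = 0 then (1 : F) else 0) u ≠ 0 ↔ g u = 0 := by
  simp only
  by_cases h : g u = 0
  · simp [h]
  · simp [h]

/-- `nzFrac [g = 0] k = 1 − nzFrac g k` on a non-empty layer. [folklore] -/
private theorem nzFrac_zeroInd (g : CubeFn F n) {k : ℕ} (hk : k ≤ n) :
    nzFrac (fun u : Fin n → Bool => if g u = 0 then (1 : F) else 0) k = 1 - nzFrac g k := by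
  have hc : (n.choose k : ℝ) ≠ 0 := by exact_mod_cast (Nat.choose_pos hk).ne'
  have hsplit := card_filter_add_card_filter_not (s := layer n k) (fun u : Fin n → Bool => g u ≠ 0)
  rw [card_layer] at hsplit
  have hset : ((layer n k).filter fun u =>
      (fun u : Fin n → Bool => if g u = 0 then (1 : F) else 0) u ≠ 0) =
      (layer n k).filter fun u => ¬ (g u ≠ 0) :=
    filter_congr fun u _ => by rw [zeroInd_ne_zero_iff]; tauto
  unfold nzFrac
  rw [hset, eq_sub_iff_add_eq, ← add_div, div_eq_one_iff_eq hc, ← Nat.cast_add, add_comm, hsplit]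

/-- For a point `x`, the number of permutations `π` with `g(x ∘ π) = 0` is `n!·(1 − ψ_{|x|})`.
[cite: Srinivasan2023, Lemma 3.10 (a^π is uniform on its layer)] -/
theorem card_perm_filter_eq_zero (g : CubeFn F n) (x : Fin n → Bool) :
    (((univ : Finset (Equiv.Perm (Fin n))).filter
        fun π : Equiv.Perm (Fin n) => g (x ∘ ⇑π) = 0).card : ℝ) =
      (Fintype.card (Equiv.Perm (Fin n)) : ℝ) * (1 - nzFrac g (wt x)) := by
  have hx : x ∈ layer n (wt x) := mem_layer_iff.2 rfl
  have h := card_perm_filter_eq_mul_nzFrac (fun u : Fin n → Bool => if g u = 0 then (1 : F) else 0)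
    (wt_le_dim x) hx
  rw [nzFrac_zeroInd g (wt_le_dim x)] at h
  rw [← h]
  congr 2
  exact filter_congr fun π _ => by rw [zeroInd_ne_zero_iff]

/-- For a point `x`, the number of `m`-tuples of permutations under which NO copy covers `x` is
`(n!·(1 − ψ_{|x|}))^m`. [cite: Srinivasan2023, Lemma 3.10 (a^π is uniform on its layer)] -/
theorem card_pi_perm_filter_forall_eq_zero (g : CubeFn F n) (x : Fin n → Bool) (m : ℕ) :
    (((univ : Finset (Fin m → Equiv.Perm (Fin n))).filter
        fun πs : Fin m → Equiv.Perm (Fin n) => ∀ i, g (x ∘ ⇑(πs i)) = 0).card : ℝ) =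
      ((Fintype.card (Equiv.Perm (Fin n)) : ℝ) * (1 - nzFrac g (wt x))) ^ m := by
  have h := card_pi_perm_filter (fun u : Fin n → Bool => if g u = 0 then (1 : F) else 0) x m
  have hset : ((univ : Finset (Fin m → Equiv.Perm (Fin n))).filter
      fun πs : Fin m → Equiv.Perm (Fin n) =>
        ∀ i, (fun u : Fin n → Bool => if g u = 0 then (1 : F) else 0) (x ∘ ⇑(πs i)) ≠ 0) =
      (univ : Finset (Fin m → Equiv.Perm (Fin n))).filter
        fun πs : Fin m → Equiv.Perm (Fin n) => ∀ i, g (x ∘ ⇑(πs i)) = 0 :=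
    filter_congr fun πs _ => forall_congr' fun i => zeroInd_ne_zero_iff g _
  have hset1 : ((univ : Finset (Equiv.Perm (Fin n))).filter
      fun π : Equiv.Perm (Fin n) =>
        (fun u : Fin n → Bool => if g u = 0 then (1 : F) else 0) (x ∘ ⇑π) ≠ 0) =
      (univ : Finset (Equiv.Perm (Fin n))).filter fun π : Equiv.Perm (Fin n) => g (x ∘ ⇑π) = 0 :=
    filter_congr fun π _ => by rw [zeroInd_ne_zero_iff]
  rw [hset, hset1] at h
  rw [← card_perm_filter_eq_zero g x, ← Nat.cast_pow, ← h]

/-- **The average cover.** Summed over all `m`-tuples of permutations, the number of points covered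
by some copy `{x : g(x ∘ π_i) ≠ 0}` is `(n!)^m · Σ_x (1 − (1 − ψ_{|x|})^m)`.
[cite: Srinivasan2023, Lemma 3.10 (a^π is uniform on its layer)] -/
theorem sum_card_cover_eq (g : CubeFn F n) (m : ℕ) :
    ∑ πs : Fin m → Equiv.Perm (Fin n),
        ((univ.filter fun x : Fin n → Bool => ∃ i, g (x ∘ ⇑(πs i)) ≠ 0).card : ℝ) =
      (Fintype.card (Equiv.Perm (Fin n)) : ℝ) ^ m *
        ∑ x : Fin n → Bool, (1 - (1 - nzFrac g (wt x)) ^ m) := by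
  classical
  -- swap the two sums
  have hswap : ∑ πs : Fin m → Equiv.Perm (Fin n),
      ((univ.filter fun x : Fin n → Bool => ∃ i, g (x ∘ ⇑(πs i)) ≠ 0).card : ℝ) =
      ∑ x : Fin n → Bool, (((univ : Finset (Fin m → Equiv.Perm (Fin n))).filter
        fun πs : Fin m → Equiv.Perm (Fin n) => ∃ i, g (x ∘ ⇑(πs i)) ≠ 0).card : ℝ) := by
    simp only [card_filter, Nat.cast_sum]
    rw [sum_comm]
  rw [hswap, mul_sum]
  refine sum_congr rfl fun x _ => ?_
  -- complement count at the point `x`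
  have hsplit := card_filter_add_card_filter_not (s := (univ : Finset (Fin m → Equiv.Perm (Fin n))))
    (fun πs : Fin m → Equiv.Perm (Fin n) => ∃ i, g (x ∘ ⇑(πs i)) ≠ 0)
  have hnot : ((univ : Finset (Fin m → Equiv.Perm (Fin n))).filter
      fun πs : Fin m → Equiv.Perm (Fin n) => ¬ ∃ i, g (x ∘ ⇑(πs i)) ≠ 0) =
      (univ : Finset (Fin m → Equiv.Perm (Fin n))).filter
        fun πs : Fin m → Equiv.Perm (Fin n) => ∀ i, g (x ∘ ⇑(πs i)) = 0 :=
    filter_congr fun πs _ => by simp only [not_exists, ne_eq, not_not]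
  rw [hnot, card_univ] at hsplit
  have hT : (Fintype.card (Fin m → Equiv.Perm (Fin n)) : ℝ) =
      (Fintype.card (Equiv.Perm (Fin n)) : ℝ) ^ m := by
    rw [Fintype.card_fun, Fintype.card_fin, Nat.cast_pow]
  have hcast : (((univ : Finset (Fin m → Equiv.Perm (Fin n))).filter
      fun πs : Fin m → Equiv.Perm (Fin n) => ∃ i, g (x ∘ ⇑(πs i)) ≠ 0).card : ℝ) =
      (Fintype.card (Equiv.Perm (Fin n)) : ℝ) ^ m -
        ((Fintype.card (Equiv.Perm (Fin n)) : ℝ) * (1 - nzFrac g (wt x))) ^ m := by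
    rw [← card_pi_perm_filter_forall_eq_zero g x m, ← hT]
    have := congrArg (fun t : ℕ => (t : ℝ)) hsplit
    push_cast at this
    linarith
  rw [hcast, mul_pow]
  ring

/-- **Symmetrisation (probabilistic method).** Some `m`-tuple of coordinate permutations covers at
least `Σ_k C(n,k)·(1 − (1 − ψ_k)^m)` points of the cube with the copies `{x : g(x ∘ π_i) ≠ 0}`.
[cite: Srinivasan2023, Lemma 3.10 (a^π is uniform on its layer)] -/
theorem exists_perms_cover (g : CubeFn F n) (m : ℕ) :
    ∃ πs : Fin m → Equiv.Perm (Fin n),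
      ∑ k ∈ range (n + 1), (n.choose k : ℝ) * (1 - (1 - nzFrac g k) ^ m) ≤
        ((univ.filter fun x : Fin n → Bool => ∃ i, g (x ∘ ⇑(πs i)) ≠ 0).card : ℝ) := by
  classical
  have hsum : ∑ _πs : Fin m → Equiv.Perm (Fin n),
      (∑ x : Fin n → Bool, (1 - (1 - nzFrac g (wt x)) ^ m)) ≤
      ∑ πs : Fin m → Equiv.Perm (Fin n),
        ((univ.filter fun x : Fin n → Bool => ∃ i, g (x ∘ ⇑(πs i)) ≠ 0).card : ℝ) := by
    rw [sum_card_cover_eq, sum_const, card_univ, nsmul_eq_mul, Fintype.card_fun, Fintype.card_fin,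
      Nat.cast_pow]
  obtain ⟨πs, _, hπs⟩ := exists_le_of_sum_le univ_nonempty hsum
  exact ⟨πs, (cov_eq_sum_layers g m).symm.le.trans hπs⟩

/-! ### Step 2: a degree-free OR-reduction — half of the sub-sums survive at a covered point -/

/-- Toggling one index `i₀` with `v i₀ ≠ 0` moves a sub-sum off zero: the sub-sums over `S` that
vanish inject into those that do not. [cite: Razborov1987, the sub-sum approximation of OR] -/
theorem card_filter_sum_eq_zero_le {ι : Type*} [DecidableEq ι] (U : Finset ι) (v : ι → F)
    {i₀ : ι} (hi₀ : i₀ ∈ U) (hv : v i₀ ≠ 0) :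
    (U.powerset.filter fun S => ∑ i ∈ S, v i = 0).card ≤
      (U.powerset.filter fun S => ∑ i ∈ S, v i ≠ 0).card := by
  -- the toggle map
  let φ : Finset ι → Finset ι := fun S => if i₀ ∈ S then S.erase i₀ else insert i₀ S
  have hφφ : ∀ S, φ (φ S) = S := by
    intro S
    by_cases h : i₀ ∈ S
    · simp only [φ, if_pos h]
      rw [if_neg (notMem_erase i₀ S), insert_erase h]
    · simp only [φ, if_neg h]
      rw [if_pos (mem_insert_self i₀ S), erase_insert h]
  have hsumφ : ∀ S, ∑ i ∈ φ S, v i ≠ 0 ↔ ∑ i ∈ S, v i ≠ v i₀ ∧ i₀ ∈ S ∨ ∑ i ∈ S, v i ≠ -v i₀ ∧ i₀ ∉ S := by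
    intro S
    by_cases h : i₀ ∈ S
    · simp only [φ, if_pos h]
      rw [sum_erase_eq_sub h]
      constructor
      · intro hne; left; exact ⟨fun heq => hne (by rw [heq, sub_self]), h⟩
      · rintro (⟨hne, _⟩ | ⟨_, hni⟩)
        · exact fun h0 => hne (sub_eq_zero.1 h0)
        · exact absurd h hni
    · simp only [φ, if_neg h]
      rw [sum_insert h]
      constructor
      · intro hne; right; exact ⟨fun heq => hne (by rw [heq, add_neg_cancel]), h⟩
      · rintro (⟨_, hi⟩ | ⟨hne, _⟩)
        · exact absurd hi h
        · exact fun h0 => hne (eq_neg_of_add_eq_zero_right h0)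
  refine card_le_card_of_injOn φ (fun S hS => ?_) (fun S _ S' _ hSS' => ?_)
  · rw [mem_coe, mem_filter, mem_powerset] at hS ⊢
    refine ⟨?_, ?_⟩
    · by_cases h : i₀ ∈ S
      · simp only [φ, if_pos h]; exact (erase_subset i₀ S).trans hS.1
      · simp only [φ, if_neg h]; exact insert_subset hi₀ hS.1
    · rw [hsumφ]
      by_cases h : i₀ ∈ S
      · left; exact ⟨by rw [hS.2]; exact hv.symm, h⟩
      · right; exact ⟨by rw [hS.2]; exact fun h0 => hv (neg_eq_zero.1 h0.symm), h⟩
  · have := congrArg φ hSS'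
    rwa [hφφ, hφφ] at this

/-- At least half of all sub-sums of a vector with a non-zero entry are non-zero:
`2 · #{S ⊆ U : Σ_S v ≠ 0} ≥ 2^{|U|}`. [cite: Razborov1987, the sub-sum approximation of OR] -/
theorem two_pow_le_two_mul_card_filter_sum_ne_zero {ι : Type*} [DecidableEq ι] (U : Finset ι)
    (v : ι → F) {i₀ : ι} (hi₀ : i₀ ∈ U) (hv : v i₀ ≠ 0) :
    2 ^ U.card ≤ 2 * (U.powerset.filter fun S => ∑ i ∈ S, v i ≠ 0).card := by
  have hsplit := card_filter_add_card_filter_not (s := U.powerset) (fun S => ∑ i ∈ S, v i = 0)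
  rw [card_powerset] at hsplit
  have h := card_filter_sum_eq_zero_le U v hi₀ hv
  have hnot : (U.powerset.filter fun S => ¬ ∑ i ∈ S, v i = 0) =
      U.powerset.filter fun S => ∑ i ∈ S, v i ≠ 0 := rfl
  rw [hnot] at hsplit
  omega

/-- **Degree-free OR-reduction** (one round of Razborov's approximation): for any finite family of
cube functions, some SUB-SUM `Σ_{i ∈ S} g_i` is non-zero on at least half of the points where some
`g_i` is non-zero. [cite: Razborov1987, the sub-sum approximation of OR] -/
theorem exists_subset_sum_support_ge {ι : Type*} [Fintype ι] [DecidableEq ι] (gs : ι → CubeFn F n) :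
    ∃ S : Finset ι, (univ.filter fun x : Fin n → Bool => ∃ i, gs i x ≠ 0).card ≤
      2 * (univ.filter fun x : Fin n → Bool => (∑ i ∈ S, gs i) x ≠ 0).card := by
  classical
  set U : Finset (Fin n → Bool) := univ.filter fun x : Fin n → Bool => ∃ i, gs i x ≠ 0 with hU
  -- double count pairs `(S, x)` with `x ∈ U` and `Σ_S g_i(x) ≠ 0`
  have hcount : U.card * 2 ^ (Fintype.card ι) ≤
      2 * ∑ S ∈ (univ : Finset ι).powerset,
        (univ.filter fun x : Fin n → Bool => (∑ i ∈ S, gs i) x ≠ 0).card := by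
    have hx : ∀ x ∈ U, 2 ^ (Fintype.card ι) ≤
        2 * ((univ : Finset ι).powerset.filter fun S => ∑ i ∈ S, gs i x ≠ 0).card := by
      intro x hx
      obtain ⟨i₀, hi₀⟩ := (mem_filter.1 hx).2
      rw [← Finset.card_univ]
      exact two_pow_le_two_mul_card_filter_sum_ne_zero univ (fun i => gs i x) (mem_univ i₀) hi₀
    calc U.card * 2 ^ (Fintype.card ι) = ∑ _x ∈ U, 2 ^ (Fintype.card ι) := by
          rw [sum_const, smul_eq_mul]
      _ ≤ ∑ x ∈ U, 2 * ((univ : Finset ι).powerset.filter fun S => ∑ i ∈ S, gs i x ≠ 0).card :=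
          sum_le_sum hx
      _ = 2 * ∑ x ∈ U, ((univ : Finset ι).powerset.filter fun S => ∑ i ∈ S, gs i x ≠ 0).card := by
          rw [mul_sum]
      _ ≤ 2 * ∑ x : Fin n → Bool,
            ((univ : Finset ι).powerset.filter fun S => ∑ i ∈ S, gs i x ≠ 0).card :=
          Nat.mul_le_mul_left 2 (sum_le_sum_of_subset_of_nonneg (filter_subset _ _)
            fun _ _ _ => Nat.zero_le _)
      _ = 2 * ∑ S ∈ (univ : Finset ι).powerset,
            (univ.filter fun x : Fin n → Bool => (∑ i ∈ S, gs i) x ≠ 0).card := by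
          congr 1
          simp only [card_filter, Finset.sum_apply]
          exact sum_comm
  -- averaging over the `2^{|ι|}` sub-sums
  have havg : ∑ _S ∈ (univ : Finset ι).powerset, U.card ≤
      ∑ S ∈ (univ : Finset ι).powerset,
        2 * (univ.filter fun x : Fin n → Bool => (∑ i ∈ S, gs i) x ≠ 0).card := by
    rw [sum_const, card_powerset, card_univ, smul_eq_mul, mul_comm, ← mul_sum]
    exact hcount
  obtain ⟨S, _, hS⟩ := exists_le_of_sum_le ⟨∅, empty_mem_powerset _⟩ havg
  exact ⟨S, hS⟩

/-! ### Permuted copies: degree and class counts -/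

/-- A permuted copy meets the class `|u| ≡ r (mod 3)` in exactly as many points as the original
(`x ↦ x ∘ π` is a weight-preserving bijection of the cube). [folklore] -/
theorem card_filter_comp_perm_class (g : CubeFn F n) (π : Equiv.Perm (Fin n)) (r : ℕ) :
    (univ.filter fun x : Fin n → Bool => g (x ∘ ⇑π) ≠ 0 ∧ wt x % 3 = r % 3).card =
      (univ.filter fun u : Fin n → Bool => g u ≠ 0 ∧ wt u % 3 = r % 3).card := by
  refine card_bij (fun x _ => x ∘ ⇑π) (fun x hx => ?_) (fun x _ y _ h => ?_)
    (fun u hu => ⟨u ∘ ⇑π.symm, ?_, ?_⟩)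
  · rw [mem_filter] at hx ⊢
    rw [wt_comp_perm]
    exact ⟨mem_univ _, hx.2⟩
  · funext i
    simpa using congrFun h (π.symm i)
  · rw [mem_filter] at hu ⊢
    have : (u ∘ ⇑π.symm) ∘ ⇑π = u := by funext i; simp
    rw [this, wt_comp_perm]
    exact ⟨mem_univ _, hu.2⟩
  · funext i; simp

end Summit.QuantumAdvantage.AdviceFreeQNC0
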